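import Summits.CriticalPhenomena.PercolationContinuityZ3.Theorems.PercNearOneGluingNoHeavyLowerTailSunflowerMultiPetalLocalMatching
import HarnessLib
import HarnessLib.Audit

/-!
# `NoHeavyLowerTail` (crux stmt-CriticalPhenomena-4575), abstract sunflower cubic, `k` petals: the INTERVAL HALL conjecture
# (an ORDER-FREE strengthening of the multi-petal partition lemma) and `IntervalHallK ⟹ PartitionLemmaK`

Support file (seat `prim-l12-p2` gen 29; `--supports stmt-CriticalPhenomena-4575`; companion of `…SunflowerMultiPetalLocalMatching`
(p344154: `slotParts`, `badParts`, `ZK_eq_slot`, `ZK_nonneg_iff_card`, `DoubledCubeHallK`) and `…SunflowerMultiPetal` (p338110: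
`MSunflower`, `PartitionLemmaK`)).  No `sorry`; the `@[conjecture]` definition is an obligation of the programme, never a fact.
Memo: run/shared/lean/prim/prim-l12/prim-l12-p2/FINDING-g29-RECTANGLE-REDUCTION.md §4.

THE STATEMENT (this work).  Read a slot `(K; S; T)` (`K` decided, `S` top, `T` bottom) as the INTERVAL `[T, T ∪ S]` of the Boolean lattice,
and a bad partition as a POINT: a bad partition with a decided block `X` (its spectator; the other two blocks are separated petal
blocks) sits at the point `X`; a rainbow (three petal blocks) may sit at ANY of its three blocks.  `IntervalHallK`: the bad ordered
partitions can be assigned injectively (multiplicity six = the six orderings, as in `DoubledCubeHallK`) to slots whose interval contains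
the chosen point: `T ⊆ X ⊆ T ∪ S`, i.e. `T ⊆ X` and `X ∩ K = ∅` (`MSunflower.IntAdj`).  No total order of the petals and no orientation of
the two petal halves is involved (contrast `DoubledCubeHallK`).  `partitionLemmaK_of_intervalHallK`: cardinalities + the slot form.

WHY THIS FORM (memo §3–§4).  Among the 343 'letter-map' Hall structures (each block of the demand may feed a prescribed subset of the
three blocks of the slot) the census leaves exactly the ones in which the slot's bottom block `T` is fed by ONE demand block and the
spectator `K` by the OTHER TWO (plus weakenings); with `T` fed by the spectator/third block the statement is order-free and survives
every reading of the rainbows, which is `IntervalHallK`.  Its mirror image (`K ⊆ X`, `T ⊆ P ∪ Q`: spectator inside the point) is FALSE on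
6 points (the doubled star = co-star(2,2,2)), as is the fixed-spectator matching `LocalMatchingK`.

THEOREM (memo §4.4; p355275 `OrientedAntipodalHall.exists_injective_blackSlot_above` / `…whiteSlot_above`, p354715 `exists_injective_disjoint_of_isLowerSet`):
the DECIDED-SPECTATOR half of the conjecture holds — the bad partitions with a decided block `X` admit an injective interval assignment with
slot spectator of the colour of `X` (prim-ineq-gen-3's transitive-tournament antipodal Hall in the cube `Xᶜ`, then a disjoint derangement of
the down-set of white parts of the goods of `Kᶜ`, via Harris–Kleitman); the open part is the rainbow half.

CENSUS (memo §4; exact matchings, this seat): ALL `(A,B)` pairs on ≤ 5 points (4 776 943 instances with demands, 18 162 070 demands):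
0 Hall failures; structured battery (all co-stars with ≤ 8 points incl. the doubled star, threshold stars, AND/atom products, the 6-point
witnesses of the refuted (LM)/(LI)/reading variants; 1 072 instance×order×reading tests): 0; adversarial local search on 6 and 7 points
(≈ 1.2·10⁵ evaluations): 0; **EXHAUSTIVE 6-point census (kit j185701, evidence on the item): all 4 824 140 739 `(A,B)` pairs with ≥ 2 components
(`U` canonical mod `S₆`, all `A ⊆ U`; 31 906 856 336 demands, 285 473 157 rainbows): 0 Hall failures.**
-/

namespace Summit.CriticalPhenomena.PercolationContinuityZ3.Theorems.SunflowerPartition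

open Finset

namespace MSunflower

variable {α : Type*} [DecidableEq α] [Fintype α] {k : ℕ} (F : MSunflower k α)

/-- INTERVAL adjacency of a bad ordered partition `q` (blocks `q.1, q.2, (q.1 ∪ q.2)ᶜ`) and a slot `s = (K, S, T)` (coded `(K, S)`,
`T = (K ∪ S)ᶜ`): some block `X` of `q` — a DECIDED block, or any block if all three blocks are petal blocks (a rainbow) — lies in the
interval `[T, T ∪ S]`, i.e. `T ⊆ X` and `X` is disjoint from the spectator `K`. [this work] -/
def IntAdj (q s : Finset α × Finset α) : Prop :=
  ∃ X : Finset α, (X = q.1 ∨ X = q.2 ∨ X = (q.1 ∪ q.2)ᶜ) ∧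
    ((F.lab X = Fin.last (k + 1) ∨ F.lab X = 0) ∨
      (¬ (F.lab q.1 = Fin.last (k + 1) ∨ F.lab q.1 = 0) ∧ ¬ (F.lab q.2 = Fin.last (k + 1) ∨ F.lab q.2 = 0) ∧
        ¬ (F.lab (q.1 ∪ q.2)ᶜ = Fin.last (k + 1) ∨ F.lab (q.1 ∪ q.2)ᶜ = 0))) ∧
    (s.1 ∪ s.2)ᶜ ⊆ X ∧ Disjoint X s.1

end MSunflower

/-- **INTERVAL HALL CONJECTURE** (this work; OPEN; census in the header and memo §4): for every `k`, every finite `α` and every monotone map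
`2^α → M_k`, the bad ordered partitions admit an injective assignment to slots-with-multiplicity-six such that each bad partition goes to a
slot `(K; S; T)` whose interval `[T, T ∪ S]` contains its decided block (or, for a rainbow, one of its blocks) — `MSunflower.IntAdj`.
Order-free (no total order of the petals is used).  Implies `PartitionLemmaK` (`partitionLemmaK_of_intervalHallK`).  An obligation, never
a fact: use as `(h : IntervalHallK)`. [status: open] -/
@[conjecture] def IntervalHallK : Prop :=
  ∀ (k : ℕ) (α : Type) [Fintype α] [DecidableEq α] (F : MSunflower k α),
    ∃ ψ : ↥F.badParts → ↥F.slotParts × Fin 6, Function.Injective ψ ∧ ∀ q, F.IntAdj q.1 (ψ q).1.1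

/-- **Interval Hall ⟹ ★ₖ** (cardinalities + the slot form `ZK = 6·#slots − #bads`). [this work] -/
theorem partitionLemmaK_of_intervalHallK (h : IntervalHallK) : PartitionLemmaK := by
  intro k α _ _ F
  obtain ⟨ψ, hψ, -⟩ := h k α F
  rw [F.ZK_nonneg_iff_card]
  have hc := Fintype.card_le_of_injective ψ hψ
  rw [Fintype.card_prod, Fintype.card_fin, Fintype.card_coe, Fintype.card_coe] at hc
  linarith

end Summit.CriticalPhenomena.PercolationContinuityZ3.Theorems.SunflowerPartition
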